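import Summits.BirchSwinnertonDyer.BirchSwinnertonDyer.Theses.GenusKolyvaginAtTwo
import HarnessLib

/-!
# Route `GenusKolyvaginAtTwo` — ONE definition the route posits: the DEEP KOLYVAGIN WITNESS AT `2` (point-level, `Frob_∞`-primes of index `≥ 2`)
# shared BY NAME by LINE 23 «twin_swap» v2.6 SUPPLY⁻ (U₂ 22985 on the odd `Δ < 0` cut) and LINE 42 «kolyvagin_structure» (Ш-cell 27477) — director-bsd (751)(3)

Seat `bsd-line-gk2-p1` g32 (LEAD lineage, cell `bsd-f1-sign2`).  One definition, nothing asserted, nothing proved; BSD is NOT proved; U₂, the Ш-cell,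
K₄⁻ and every line stub stay OPEN.

WHY (director-bsd (751)(3), pen bsd-idea-1 g30 04:48:39Z ALIGNMENT ASK).  Two lines need «one deep Kolyvagin witness at `2`» for the rank-one member
`W` at an odd Heegner frame `K`: gk2-p2's SUPPLY⁻ (p810945 `…TwinAnnihilation.minimalTwinBSDTwo_onOddNegCut_of_wall_of_witnessSupply_of_facts`) in the
POINT-LEVEL form «a square-free `n` of deep Kolyvagin primes with `P(n) ∉ 2W(K[n])`», and the pen's LINE 42 U1♯′/STRUCT₂′ in a CLASS-LEVEL form «a
class `c_M(n)` of order `≥ 2^{M−t}`».  The LEAD's pick is the POINT-LEVEL text below, because it is ALREADY the route's currency, verbatim: it is the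
witness clause of the items `K4Neg` (31526), `K4NegDepthOneOnCut`, `GenusDeepSupplyAtTwoNegDisc(Narrow)` in `Theses/GenusKolyvaginAtTwo.lean`, the
hypothesis block `(n) (d) (hn) (hdeep) (hPn)` of the CLOSED lower half L_T `powDvdShaCardAtTwoRT_proof` (item 23659; NO root-number, NO Selmer binder —
so it serves the Ш-cell's `Δ < 0` habitat frames verbatim), and gk2-p2's SUPPLY⁻.  The class-level form is DERIVED data (point-level ⟹ class-level is
the at-`2` Kolyvagin-class non-vanishing step, part of LINE 42's own research content), so LINE 42 imports this predicate and keeps that step as its stub.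
PRINT ANCHOR: McCallum, *Kolyvagin's work on Shafarevich–Tate groups* (LMS LN 153, 1991) §5 — the admissible sets `S_r(M)` of square-free products of
Kolyvagin primes and the divisibility order of `P_n` («`n ∈ S_r(ord_p P_n + 1)`», p. 284 of the held volume); Kolyvagin 1989 Thm. B; W. Zhang 2014
Def. 3.1 / Thm. 1.1 (Kolyvagin primes, the `p ≥ 5` theorem whose `p = 2` analogue these lines attack).  At `2` the route's convention (items above) adds
Zhang's index condition `2 ≤ kolyvaginIndex W 2 ℓ` («deep») and `Frob_ℓ = Frob_∞` in `ℚ(W[4])/ℚ` (the `Δ < 0` sign choice, `FrobEqFrobInfty`); the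
`Δ > 0` items (`K4Pos`, …) use a different Frobenius class and are NOT covered by this name (state them with the route's `K4Pos` clause).

Reference texts: [McCallumLMS1991] §5 (S_r(M), Thm. 5.4, Thm. 5.8); [Kolyvagin1989Izv] Thm. B; [WZhang2014] Def. 3.1, Thm. 1.1; [GrossLMS1991] §3–§5.
-/

set_option autoImplicit false
set_option linter.dupNamespace false -- `Summit.<P>.<Sub>` repeats `BirchSwinnertonDyer` (D-0017)

noncomputable section

open scoped Classical

namespace Summit.BirchSwinnertonDyer.BirchSwinnertonDyer.Theorems.GenusExact.DeepWitness

open WeierstrassCurve Literature.NumberTheory.EllipticCurves Literature.NumberTheory.EllipticCurves.ModularForms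

/-- **THE DEEP KOLYVAGIN WITNESS AT `2`** (point-level, `Δ < 0` sign convention) for `W/ℚ` of conductor `N`, an imaginary quadratic `K`, a modular
parametrisation datum `Dt` at level `N`, and the Heegner data `(β, ι)`: there are a square-free `n` and Kolyvagin–Heegner data `d` of conductor `n`
such that every prime `ℓ ∣ n` is a Kolyvagin prime for `(W, K, 2)` in W. Zhang's sense, DEEP (`2 ≤ kolyvaginIndex W 2 ℓ`, i.e. `4 ∣ a_ℓ, ℓ + 1`) and with
`Frob_ℓ = Frob_∞`, and the derived Heegner point `P(n) ∈ W(K[n])` is NOT `2`-divisible there.  This is McCallum's admissibility «`n ∈ S_r(ord₂ P_n + 1)`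
with `ord₂ P_n = 0`» at `p = 2` ([McCallumLMS1991] §5, p. 284) in the route's typed vocabulary; it is, character for character, the witness clause of
the route items `K4Neg` / `GenusDeepSupplyAtTwoNegDisc` and the hypothesis block of the closed lower half `powDvdShaCardAtTwoRT_proof`.  A DEFINITION:
nothing is asserted. [cite: McCallumLMS1991, §5 (admissible sets S_r(M), Thm. 5.4)] [cite: WZhang2014, Def. 3.1 and Thm. 1.1] [cite: Kolyvagin1989Izv, Thm. B] -/
def HasDeepKolyvaginWitnessAtTwo (W : WeierstrassCurve ℚ) [W.IsElliptic] [W.IsGloballyMinimal] [NeZero (W.conductorNorm ℤ)]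
    (K : Type) [Field K] [NumberField K]
    (Dt : ModularParametrizationData W (W.conductorNorm ℤ)) (β : ℤ) (ι : K →+* ℂ) : Prop :=
  ∃ (n : ℕ) (d : KolyvaginHeegnerData Dt β ι n), Squarefree n ∧
    (∀ ℓ ∈ n.primeFactors, Zhang2014.IsKolyvaginPrime (W.conductorNorm ℤ) W K 2 ℓ ∧ 2 ≤ Zhang2014.kolyvaginIndex W 2 ℓ ∧
      FrobEqFrobInfty W K 2 ℓ) ∧
    ¬ ∃ Q : (W.baseChange (ringClassField K ι n)).toAffine.Point, (2 : ℤ) • Q = d.derivedPoint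

/-- Unfolding lemma: `HasDeepKolyvaginWitnessAtTwo` IS the route's inline witness clause (so a consumer holding the clause, e.g. the binders
`(n) (d) (hn) (hdeep) (hPn)` of `powDvdShaCardAtTwoRT_proof`, passes to the name by `Iff.rfl`). [folklore] -/
theorem hasDeepKolyvaginWitnessAtTwo_iff (W : WeierstrassCurve ℚ) [W.IsElliptic] [W.IsGloballyMinimal] [NeZero (W.conductorNorm ℤ)]
    (K : Type) [Field K] [NumberField K]
    (Dt : ModularParametrizationData W (W.conductorNorm ℤ)) (β : ℤ) (ι : K →+* ℂ) :
    HasDeepKolyvaginWitnessAtTwo W K Dt β ι ↔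
      ∃ (n : ℕ) (d : KolyvaginHeegnerData Dt β ι n), Squarefree n ∧
        (∀ ℓ ∈ n.primeFactors, Zhang2014.IsKolyvaginPrime (W.conductorNorm ℤ) W K 2 ℓ ∧ 2 ≤ Zhang2014.kolyvaginIndex W 2 ℓ ∧
          FrobEqFrobInfty W K 2 ℓ) ∧
        ¬ ∃ Q : (W.baseChange (ringClassField K ι n)).toAffine.Point, (2 : ℤ) • Q = d.derivedPoint :=
  Iff.rfl

end Summit.BirchSwinnertonDyer.BirchSwinnertonDyer.Theorems.GenusExact.DeepWitness

end
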